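import Summits.NavierStokesRegularity.NavierStokesRegularity.Theorems.SwirlFreeBudget
import Summits.NavierStokesRegularity.NavierStokesRegularity.Theorems.MeridionalBarrierFrame
import Mathlib.Analysis.SpecialFunctions.PolarCoord
import Mathlib.MeasureTheory.Constructions.Pi
import Mathlib.MeasureTheory.Measure.Haar.InnerProductSpace
import HarnessLib

/-!
# ROUND-18 (nsreg-p2, gen 20) — `SwirlFreeBudget`, part 2 (§5): R17's meridional Péclet gauge is
# velocity-dominated (S-18.1, `c₁ = 4π`) and the instantiated swirl-free budget law `N₀^{full}`

Second half of planner nsreg-p2's companion `R18-SwirlFreeBudget.lean` (sha16 3722b743a4316dc3), split for the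
400-line rule and RE-POINTED: the companion's verbatim interface copies of R17's `northwardMoment`,
`northwardDensity`, `southwardDensity`, `shellWindow`, `northwardPeclet`, `southwardPeclet`,
`meridionalPeclet` are replaced by the tree declarations of `…Theorems.MeridionalBarrier`
(`…Theorems.MeridionalBarrierFrame`), so S-18.1 and the joins below are stated for R17's actual gauge; the companion's helper `norm_sq_three` is
inlined (it restates the tree's `Literature.Algebra.EuclideanLattices.norm_sq_fin_three` — gate dedup rule).
See the module docstring of `…Theorems.SwirlFreeBudget` (§§1–4) for the mechanism and sources.
Contents: `shellWindow_subset_parabolicCylinder`; S-18.1 PROVED — `abs_northwardMoment_le`,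
`northwardDensity_le` / `southwardDensity_le` (`≤ ‖v‖/r`), the axis kernel `lintegral_ball_inv_cylRadius_le`
(`∫_{B_ρ} dy/r ≤ 4πρ²`), `setLIntegral_shellWindow_le`, `northwardPeclet_velocityDominated`,
`southwardPeclet_velocityDominated`, `meridionalPeclet_velocityDominated`, `MeridionalPecletDominated` /
`meridionalPecletDominated_holds`; the instantiated joins `meridionalBudget_of_polynomialBound`,
`meridionalBudgetA_of_polynomialBoundA`.
hard core evaded: all eight — measure theory on a gauge functional; no NS regularity statement.
-/

namespace Summit.NavierStokesRegularity.NavierStokesRegularity.Theorems.SwirlFreeBudget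

open MeasureTheory Set Filter Topology Metric
open scoped ENNReal NNReal
open Literature.Analysis Literature.Analysis.FluidPDE
open Literature.Analysis.FluidPDE.SereginZajaczkowski2007

open Summit.NavierStokesRegularity.NavierStokesRegularity.Theorems.MeridionalBarrier
  (northwardMoment northwardDensity southwardDensity shellWindow northwardPeclet southwardPeclet
    meridionalPeclet)

noncomputable section
/-! ## 5. R17's meridional Péclet gauge (interface copy) and the instantiated law `N₀^{full}` -/

/-- The shell window sits inside the parabolic cylinder of the same scale. -/
theorem shellWindow_subset_parabolicCylinder (ρ : ℝ) (z : ℝ × EuclideanSpace ℝ (Fin 3)) :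
    shellWindow ρ z ⊆ parabolicCylinder ρ z := by
  intro w hw
  rw [mem_parabolicCylinder]
  simp only [shellWindow, mem_prod, mem_Ioo, mem_setOf_eq] at hw
  exact ⟨hw.1, mem_ball.2 hw.2.2⟩

/-! ### S-18.1 PROVED: the meridional Péclet gauge is velocity-dominated (`c₁ = 4π`) -/

/-- **Cauchy–Schwarz in the meridional plane**: `|moment| ≤ r · |x - x₀| · |v x|`. -/
theorem abs_northwardMoment_le (v : EuclideanSpace ℝ (Fin 3) → EuclideanSpace ℝ (Fin 3))
    (x₀ x : EuclideanSpace ℝ (Fin 3)) :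
    |northwardMoment v x₀ x| ≤ cylRadius (x - x₀) * ‖x - x₀‖ * ‖v x‖ := by
  have hS : cylRadius (x - x₀) ^ 2 = (x - x₀) 0 ^ 2 + (x - x₀) 1 ^ 2 := cylRadius_sq _
  have hy : ‖x - x₀‖ ^ 2 = (x - x₀) 0 ^ 2 + (x - x₀) 1 ^ 2 + (x - x₀) 2 ^ 2 :=
    (by rw [EuclideanSpace.real_norm_sq_eq, Fin.sum_univ_three])
  have hw : ‖v x‖ ^ 2 = v x 0 ^ 2 + v x 1 ^ 2 + v x 2 ^ 2 :=
    (by rw [EuclideanSpace.real_norm_sq_eq, Fin.sum_univ_three])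
  have hP : 0 ≤ cylRadius (x - x₀) * ‖x - x₀‖ * ‖v x‖ := by
    have := cylRadius_nonneg (x - x₀)
    positivity
  rw [← abs_of_nonneg hP]
  refine sq_le_sq.mp ?_
  have hm : northwardMoment v x₀ x =
      cylRadius (x - x₀) ^ 2 * v x 2 - (x - x₀) 2 * ((x - x₀) 0 * v x 0 + (x - x₀) 1 * v x 1) :=
    rfl
  rw [hm, mul_pow, mul_pow, hy, hw, hS]
  nlinarith [mul_nonneg (add_nonneg (sq_nonneg ((x - x₀) 0)) (sq_nonneg ((x - x₀) 1)))
      (sq_nonneg ((x - x₀) 0 * v x 0 + (x - x₀) 1 * v x 1 + (x - x₀) 2 * v x 2)),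
    mul_nonneg (add_nonneg (add_nonneg (sq_nonneg ((x - x₀) 0)) (sq_nonneg ((x - x₀) 1)))
      (sq_nonneg ((x - x₀) 2))) (sq_nonneg ((x - x₀) 0 * v x 1 - (x - x₀) 1 * v x 0))]

/-- The northward Péclet density is at most `|v x| / r`. -/
theorem northwardDensity_le (v : EuclideanSpace ℝ (Fin 3) → EuclideanSpace ℝ (Fin 3))
    (x₀ x : EuclideanSpace ℝ (Fin 3)) :
    northwardDensity v x₀ x ≤ ‖v x‖ / cylRadius (x - x₀) := by
  unfold northwardDensity
  have hr := cylRadius_nonneg (x - x₀)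
  rcases eq_or_lt_of_le hr with h0 | hpos
  · rw [← h0]; simp
  rcases eq_or_lt_of_le (norm_nonneg (x - x₀)) with hn | hn
  · rw [← hn]; simp; positivity
  rw [div_le_div_iff₀ (by positivity) hpos]
  calc max (northwardMoment v x₀ x) 0 * cylRadius (x - x₀)
      ≤ |northwardMoment v x₀ x| * cylRadius (x - x₀) := by
        gcongr; exact max_le (le_abs_self _) (abs_nonneg _)
    _ ≤ (cylRadius (x - x₀) * ‖x - x₀‖ * ‖v x‖) * cylRadius (x - x₀) := by
        gcongr; exact abs_northwardMoment_le v x₀ x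
    _ = ‖v x‖ * (‖x - x₀‖ * cylRadius (x - x₀) ^ 2) := by ring

/-- The southward Péclet density is at most `|v x| / r`. -/
theorem southwardDensity_le (v : EuclideanSpace ℝ (Fin 3) → EuclideanSpace ℝ (Fin 3))
    (x₀ x : EuclideanSpace ℝ (Fin 3)) :
    southwardDensity v x₀ x ≤ ‖v x‖ / cylRadius (x - x₀) := by
  unfold southwardDensity
  have hr := cylRadius_nonneg (x - x₀)
  rcases eq_or_lt_of_le hr with h0 | hpos
  · rw [← h0]; simp
  rcases eq_or_lt_of_le (norm_nonneg (x - x₀)) with hn | hn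
  · rw [← hn]; simp; positivity
  rw [div_le_div_iff₀ (by positivity) hpos]
  calc max (-northwardMoment v x₀ x) 0 * cylRadius (x - x₀)
      ≤ |northwardMoment v x₀ x| * cylRadius (x - x₀) := by
        gcongr; exact max_le (neg_le_abs _) (abs_nonneg _)
    _ ≤ (cylRadius (x - x₀) * ‖x - x₀‖ * ‖v x‖) * cylRadius (x - x₀) := by
        gcongr; exact abs_northwardMoment_le v x₀ x
    _ = ‖v x‖ * (‖x - x₀‖ * cylRadius (x - x₀) ^ 2) := by ring


/-- The meridional cross-section kernel: `∫_{ℝ²} 1_{|w| < ρ} / |w| dw = 2πρ` (polar coordinates). -/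
theorem lintegral_disc_inv_norm {ρ : ℝ} (hρ : 0 < ρ) :
    ∫⁻ w : ℝ × ℝ, {w : ℝ × ℝ | w.1 ^ 2 + w.2 ^ 2 < ρ ^ 2}.indicator
        (fun w => ENNReal.ofReal (Real.sqrt (w.1 ^ 2 + w.2 ^ 2))⁻¹) w
      = ENNReal.ofReal (2 * Real.pi * ρ) := by
  rw [← lintegral_comp_polarCoord_symm]
  have hfun : ∀ p ∈ polarCoord.target,
      ENNReal.ofReal p.1 • {w : ℝ × ℝ | w.1 ^ 2 + w.2 ^ 2 < ρ ^ 2}.indicator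
          (fun w => ENNReal.ofReal (Real.sqrt (w.1 ^ 2 + w.2 ^ 2))⁻¹) (polarCoord.symm p)
        = (Iio ρ ×ˢ (univ : Set ℝ)).indicator (1 : ℝ × ℝ → ℝ≥0∞) p := by
    intro p hp
    rw [polarCoord_target] at hp
    have hp1 : 0 < p.1 := hp.1
    have hsq : (p.1 * Real.cos p.2) ^ 2 + (p.1 * Real.sin p.2) ^ 2 = p.1 ^ 2 := by
      nlinarith [Real.sin_sq_add_cos_sq p.2]
    rw [polarCoord_symm_apply, smul_eq_mul]
    by_cases hlt : p.1 < ρ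
    · have hmem : (p.1 * Real.cos p.2, p.1 * Real.sin p.2) ∈
          {w : ℝ × ℝ | w.1 ^ 2 + w.2 ^ 2 < ρ ^ 2} := by
        simp only [mem_setOf_eq]
        rw [hsq]
        exact pow_lt_pow_left₀ hlt hp1.le two_ne_zero
      have hmem' : p ∈ Iio ρ ×ˢ (univ : Set ℝ) := ⟨hlt, mem_univ _⟩
      rw [indicator_of_mem hmem, indicator_of_mem hmem', Pi.one_apply]
      simp only
      rw [hsq, Real.sqrt_sq hp1.le, ← ENNReal.ofReal_mul hp1.le, mul_inv_cancel₀ hp1.ne',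
        ENNReal.ofReal_one]
    · have hnmem : (p.1 * Real.cos p.2, p.1 * Real.sin p.2) ∉
          {w : ℝ × ℝ | w.1 ^ 2 + w.2 ^ 2 < ρ ^ 2} := by
        simp only [mem_setOf_eq, not_lt]
        rw [hsq]
        exact pow_le_pow_left₀ hρ.le (not_lt.1 hlt) 2
      have hnmem' : p ∉ Iio ρ ×ˢ (univ : Set ℝ) := fun h => hlt h.1
      rw [indicator_of_notMem hnmem, indicator_of_notMem hnmem', mul_zero]
  rw [setLIntegral_congr_fun polarCoord.open_target.measurableSet hfun,
    lintegral_indicator_one (measurableSet_Iio.prod MeasurableSet.univ),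
    Measure.restrict_apply (measurableSet_Iio.prod MeasurableSet.univ), polarCoord_target,
    Set.prod_inter_prod, univ_inter, Set.Iio_inter_Ioi, Measure.volume_eq_prod, Measure.prod_prod,
    Real.volume_Ioo, Real.volume_Ioo, ← ENNReal.ofReal_mul (by linarith : (0 : ℝ) ≤ ρ - 0)]
  congr 1
  ring

/-- **The axis kernel**: `∫_{B(x₀,ρ)} dx / r(x - x₀) ≤ 4π ρ²` (`r` = distance to the axis through
`x₀`; the ball sits in the cylinder `{|x₂ - x₀,₂| < ρ} × {r < ρ}`, whose kernel integral is
`2ρ · 2πρ` by polar coordinates in the meridional cross-section). -/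
theorem lintegral_ball_inv_cylRadius_le (x₀ : EuclideanSpace ℝ (Fin 3)) {ρ : ℝ} (hρ : 0 < ρ) :
    ∫⁻ x in ball x₀ ρ, ENNReal.ofReal (cylRadius (x - x₀))⁻¹
      ≤ ENNReal.ofReal (4 * Real.pi * ρ ^ 2) := by
  classical
  set F : EuclideanSpace ℝ (Fin 3) → ℝ≥0∞ := fun y => ENNReal.ofReal (cylRadius y)⁻¹ with hF
  -- (a) translate to the origin
  have htr : ∫⁻ x in ball x₀ ρ, ENNReal.ofReal (cylRadius (x - x₀))⁻¹
      = ∫⁻ y in ball (0 : EuclideanSpace ℝ (Fin 3)) ρ, F y := by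
    have hmp : MeasurePreserving (fun x : EuclideanSpace ℝ (Fin 3) => x - x₀) volume volume :=
      measurePreserving_sub_right volume x₀
    have hemb : MeasurableEmbedding (fun x : EuclideanSpace ℝ (Fin 3) => x - x₀) :=
      (MeasurableEquiv.subRight x₀).measurableEmbedding
    have hpre : (fun x : EuclideanSpace ℝ (Fin 3) => x - x₀) ⁻¹'
        ball (0 : EuclideanSpace ℝ (Fin 3)) ρ = ball x₀ ρ := by
      ext x
      simp [mem_ball, dist_eq_norm]
    rw [← hpre]
    exact hmp.setLIntegral_comp_preimage_emb hemb F (ball 0 ρ)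
  rw [htr, ← lintegral_indicator measurableSet_ball]
  -- (b) the comparison function on `ℝ × (ℝ × ℝ)` (height × meridional cross-section)
  set D : Set (ℝ × ℝ) := {w : ℝ × ℝ | w.1 ^ 2 + w.2 ^ 2 < ρ ^ 2} with hD
  have hDm : MeasurableSet D :=
    measurableSet_lt (((continuous_fst.pow 2).add (continuous_snd.pow 2)).measurable)
      measurable_const
  set h : ℝ × ℝ → ℝ≥0∞ := fun w => ENNReal.ofReal (Real.sqrt (w.1 ^ 2 + w.2 ^ 2))⁻¹ with hh
  have hhm : Measurable h :=
    ENNReal.measurable_ofReal.comp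
      (((continuous_fst.pow 2).add (continuous_snd.pow 2)).sqrt.measurable.inv)
  set G : ℝ × (ℝ × ℝ) → ℝ≥0∞ :=
    fun p => (Ioo (-ρ) ρ).indicator (1 : ℝ → ℝ≥0∞) p.1 * D.indicator h p.2 with hG
  have hG1m : Measurable fun c : ℝ => (Ioo (-ρ) ρ).indicator (1 : ℝ → ℝ≥0∞) c :=
    measurable_one.indicator measurableSet_Ioo
  have hG2m : Measurable fun w : ℝ × ℝ => D.indicator h w := hhm.indicator hDm
  have hGm : Measurable G := (hG1m.comp measurable_fst).mul (hG2m.comp measurable_snd)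
  -- (c) the coordinate map `y ↦ (y₂, (y₀, y₁))` preserves Lebesgue measure
  set Φ : EuclideanSpace ℝ (Fin 3) → ℝ × (ℝ × ℝ) := fun y => (y 2, (y 0, y 1)) with hΦdef
  have hΦ : MeasurePreserving Φ volume volume := by
    have h1 : MeasurePreserving (@WithLp.ofLp 2 (Fin 3 → ℝ)) volume volume :=
      PiLp.volume_preserving_ofLp (Fin 3)
    have h2 : MeasurePreserving (MeasurableEquiv.piFinSuccAbove (fun _ : Fin 3 => ℝ) 2)
        volume volume :=
      volume_preserving_piFinSuccAbove (fun _ : Fin 3 => ℝ) 2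
    have h3 : MeasurePreserving (Prod.map id (@MeasurableEquiv.finTwoArrow ℝ _))
        (volume : Measure (ℝ × (Fin 2 → ℝ))) (volume : Measure (ℝ × (ℝ × ℝ))) :=
      (MeasurePreserving.id (volume : Measure ℝ)).prod (volume_preserving_finTwoArrow ℝ)
    have h123 := (h3.comp h2).comp h1
    have heq : (Prod.map id (@MeasurableEquiv.finTwoArrow ℝ _)) ∘
        (MeasurableEquiv.piFinSuccAbove (fun _ : Fin 3 => ℝ) 2) ∘ (@WithLp.ofLp 2 (Fin 3 → ℝ))
          = Φ := by
      funext y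
      rfl
    rw [← heq]
    exact h123
  -- (d) pointwise comparison `1_{B_ρ} F ≤ G ∘ Φ`
  have hpt : ∀ y, (ball (0 : EuclideanSpace ℝ (Fin 3)) ρ).indicator F y ≤ G (Φ y) := by
    intro y
    by_cases hy : y ∈ ball (0 : EuclideanSpace ℝ (Fin 3)) ρ
    · rw [indicator_of_mem hy]
      have hn : ‖y‖ < ρ := mem_ball_zero_iff.1 hy
      have hsq : ‖y‖ ^ 2 = y 0 ^ 2 + y 1 ^ 2 + y 2 ^ 2 :=
        (by rw [EuclideanSpace.real_norm_sq_eq, Fin.sum_univ_three])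
      have hn2 : ‖y‖ ^ 2 < ρ ^ 2 := pow_lt_pow_left₀ hn (norm_nonneg _) two_ne_zero
      have h2 : y 2 ∈ Ioo (-ρ) ρ := by
        have h22 : (y 2) ^ 2 < ρ ^ 2 := by nlinarith [sq_nonneg (y 0), sq_nonneg (y 1)]
        have := abs_lt_of_sq_lt_sq h22 hρ.le
        exact ⟨(abs_lt.1 this).1, (abs_lt.1 this).2⟩
      have hDy : (y 0, y 1) ∈ D := by
        simp only [hD, mem_setOf_eq]
        nlinarith [sq_nonneg (y 2)]
      simp only [hG, hΦdef, indicator_of_mem h2, indicator_of_mem hDy, Pi.one_apply, one_mul, hh, hF]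
      exact le_rfl
    · rw [indicator_of_notMem hy]
      exact bot_le
  -- (e) integrate: Fubini splits height from cross-section; the cross-section is `2πρ`
  have hIoo : ∫⁻ c : ℝ, (Ioo (-ρ) ρ).indicator (1 : ℝ → ℝ≥0∞) c = ENNReal.ofReal (2 * ρ) := by
    rw [lintegral_indicator_one measurableSet_Ioo, Real.volume_Ioo]
    congr 1
    ring
  have hdisc : ∫⁻ w : ℝ × ℝ, D.indicator h w = ENNReal.ofReal (2 * Real.pi * ρ) :=
    lintegral_disc_inv_norm hρ
  calc ∫⁻ y, (ball (0 : EuclideanSpace ℝ (Fin 3)) ρ).indicator F y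
      ≤ ∫⁻ y, G (Φ y) := lintegral_mono hpt
    _ = ∫⁻ p, G p := hΦ.lintegral_comp hGm
    _ = (∫⁻ c : ℝ, (Ioo (-ρ) ρ).indicator (1 : ℝ → ℝ≥0∞) c) * ∫⁻ w : ℝ × ℝ, D.indicator h w := by
        rw [Measure.volume_eq_prod]
        exact lintegral_prod_mul hG1m.aemeasurable hG2m.aemeasurable
    _ = ENNReal.ofReal (2 * ρ) * ENNReal.ofReal (2 * Real.pi * ρ) := by rw [hIoo, hdisc]
    _ = ENNReal.ofReal (4 * Real.pi * ρ ^ 2) := by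
        rw [← ENNReal.ofReal_mul (by positivity)]
        congr 1
        ring

/-- **Reduction**: any density dominated by `|v x| / r` has shell-window integral
`≤ L · 4π · ρ⁴` when `|u| ≤ L` a.e. on `Q(z, ρ)`. -/
theorem setLIntegral_shellWindow_le {ρ L : ℝ} (hρ : 0 < ρ) (hL : 0 ≤ L)
    (z : ℝ × EuclideanSpace ℝ (Fin 3))
    (u : ℝ → EuclideanSpace ℝ (Fin 3) → EuclideanSpace ℝ (Fin 3))
    (dens : (EuclideanSpace ℝ (Fin 3) → EuclideanSpace ℝ (Fin 3)) →
      EuclideanSpace ℝ (Fin 3) → EuclideanSpace ℝ (Fin 3) → ℝ)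
    (hdens : ∀ v x₀ x, dens v x₀ x ≤ ‖v x‖ / cylRadius (x - x₀))
    (hu : ∀ᵐ q ∂(volume.restrict (parabolicCylinder ρ z)), ‖u q.1 q.2‖ ≤ L) :
    ∫⁻ q in shellWindow ρ z, ENNReal.ofReal (dens (u q.1) z.2 q.2)
      ≤ ENNReal.ofReal (L * (4 * Real.pi) * ρ ^ 4) := by
  have hu' : ∀ᵐ q ∂(volume.restrict (shellWindow ρ z)), ‖u q.1 q.2‖ ≤ L :=
    ae_restrict_of_ae_restrict_of_subset (shellWindow_subset_parabolicCylinder ρ z) hu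
  set g : ℝ × EuclideanSpace ℝ (Fin 3) → ℝ≥0∞ :=
    fun q => ENNReal.ofReal L * ENNReal.ofReal (cylRadius (q.2 - z.2))⁻¹ with hg
  -- (1) a.e. domination on the shell window
  have h1 : ∫⁻ q in shellWindow ρ z, ENNReal.ofReal (dens (u q.1) z.2 q.2)
      ≤ ∫⁻ q in shellWindow ρ z, g q := by
    refine lintegral_mono_ae (hu'.mono fun q hq => ?_)
    simp only [hg]
    rw [← ENNReal.ofReal_mul hL]
    refine ENNReal.ofReal_le_ofReal ?_
    calc dens (u q.1) z.2 q.2 ≤ ‖u q.1 q.2‖ / cylRadius (q.2 - z.2) := hdens _ _ _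
      _ ≤ L / cylRadius (q.2 - z.2) := div_le_div_of_nonneg_right hq (cylRadius_nonneg _)
      _ = L * (cylRadius (q.2 - z.2))⁻¹ := div_eq_mul_inv _ _
  -- (2) enlarge the window to the full cylinder `Ioo × ball`
  have h2 : ∫⁻ q in shellWindow ρ z, g q ≤ ∫⁻ q in Ioo (z.1 - ρ ^ 2) z.1 ×ˢ ball z.2 ρ, g q := by
    refine lintegral_mono_set fun q hq => ?_
    simp only [shellWindow, mem_prod, mem_Ioo, mem_setOf_eq] at hq
    exact ⟨hq.1, mem_ball.2 hq.2.2⟩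
  -- (3) product structure: the integrand does not see time
  have hfm : Measurable fun x : EuclideanSpace ℝ (Fin 3) =>
      ENNReal.ofReal L * ENNReal.ofReal (cylRadius (x - z.2))⁻¹ :=
    (ENNReal.measurable_ofReal.comp
      ((continuous_cylRadius.measurable.comp (measurable_id.sub_const _)).inv)).const_mul _
  have hgm : Measurable g := hfm.comp measurable_snd
  have h3 : ∫⁻ q in Ioo (z.1 - ρ ^ 2) z.1 ×ˢ ball z.2 ρ, g q
      = volume (Ioo (z.1 - ρ ^ 2) z.1) *
        ∫⁻ x in ball z.2 ρ, ENNReal.ofReal L * ENNReal.ofReal (cylRadius (x - z.2))⁻¹ := by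
    rw [Measure.volume_eq_prod, setLIntegral_prod _ hgm.aemeasurable]
    simp only [hg]
    rw [setLIntegral_const, mul_comm]
  -- (4) the time window has length `ρ²`; the space integral is `L ·` the axis kernel
  have h4 : volume (Ioo (z.1 - ρ ^ 2) z.1) = ENNReal.ofReal (ρ ^ 2) := by
    rw [Real.volume_Ioo]; congr 1; ring
  have h5 : ∫⁻ x in ball z.2 ρ, ENNReal.ofReal L * ENNReal.ofReal (cylRadius (x - z.2))⁻¹
      ≤ ENNReal.ofReal L * ENNReal.ofReal (4 * Real.pi * ρ ^ 2) := by
    rw [lintegral_const_mul' _ _ ENNReal.ofReal_ne_top]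
    gcongr
    exact lintegral_ball_inv_cylRadius_le z.2 hρ
  calc ∫⁻ q in shellWindow ρ z, ENNReal.ofReal (dens (u q.1) z.2 q.2)
      ≤ ∫⁻ q in Ioo (z.1 - ρ ^ 2) z.1 ×ˢ ball z.2 ρ, g q := h1.trans h2
    _ ≤ ENNReal.ofReal (ρ ^ 2) * (ENNReal.ofReal L * ENNReal.ofReal (4 * Real.pi * ρ ^ 2)) := by
        rw [h3, h4]; gcongr
    _ = ENNReal.ofReal (L * (4 * Real.pi) * ρ ^ 4) := by
        rw [← ENNReal.ofReal_mul hL, ← ENNReal.ofReal_mul (sq_nonneg ρ)]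
        congr 1; ring

/-- **S-18.1 (northward)**: the northward Péclet number is velocity-dominated, `c₁ = 4π`. -/
theorem northwardPeclet_velocityDominated : VelocityDominated (4 * Real.pi) northwardPeclet := by
  intro ρ z u L hρ hL hu
  unfold northwardPeclet
  have h := setLIntegral_shellWindow_le hρ hL z u northwardDensity northwardDensity_le hu
  calc (ENNReal.ofReal ρ ^ 3)⁻¹ *
        ∫⁻ q in shellWindow ρ z, ENNReal.ofReal (northwardDensity (u q.1) z.2 q.2)
      ≤ (ENNReal.ofReal ρ ^ 3)⁻¹ * ENNReal.ofReal (L * (4 * Real.pi) * ρ ^ 4) := by gcongr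
    _ = ENNReal.ofReal (4 * Real.pi * L * ρ) := by
        rw [← ENNReal.ofReal_pow hρ.le, ← ENNReal.ofReal_inv_of_pos (pow_pos hρ 3),
          ← ENNReal.ofReal_mul (inv_nonneg.2 (pow_pos hρ 3).le)]
        congr 1
        field_simp

/-- **S-18.1 (southward)**: the southward Péclet number is velocity-dominated, `c₁ = 4π`. -/
theorem southwardPeclet_velocityDominated : VelocityDominated (4 * Real.pi) southwardPeclet := by
  intro ρ z u L hρ hL hu
  unfold southwardPeclet
  have h := setLIntegral_shellWindow_le hρ hL z u southwardDensity southwardDensity_le hu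
  calc (ENNReal.ofReal ρ ^ 3)⁻¹ *
        ∫⁻ q in shellWindow ρ z, ENNReal.ofReal (southwardDensity (u q.1) z.2 q.2)
      ≤ (ENNReal.ofReal ρ ^ 3)⁻¹ * ENNReal.ofReal (L * (4 * Real.pi) * ρ ^ 4) := by gcongr
    _ = ENNReal.ofReal (4 * Real.pi * L * ρ) := by
        rw [← ENNReal.ofReal_pow hρ.le, ← ENNReal.ofReal_inv_of_pos (pow_pos hρ 3),
          ← ENNReal.ofReal_mul (inv_nonneg.2 (pow_pos hρ 3).le)]
        congr 1
        field_simp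

/-- **S-18.1**: the meridional Péclet gauge is velocity-dominated with `c₁ = 4π`. -/
theorem meridionalPeclet_velocityDominated : VelocityDominated (4 * Real.pi) meridionalPeclet :=
  fun ρ z u L hρ hL hu =>
    (min_le_left _ _).trans (northwardPeclet_velocityDominated ρ z u L hρ hL hu)


/-- **S-18.1 (support, measure theory) `MeridionalPecletDominated`** — PROVED
(`meridionalPecletDominated_holds`): the meridional Péclet gauge is velocity-dominated with
`c₁ = 4π` (`|northwardMoment| ≤ r ϱ |v|` by Cauchy–Schwarz in the meridional plane, so both
densities are `≤ |v|/r`; the shell window sits in `(t₀-ρ², t₀) × B_ρ`, and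
`∫_{B_ρ} dy/r ≤ ∫_{|y₂|<ρ} ∫_{|w|<ρ} dw/|w| = 2ρ · 2πρ` by Fubini and polar coordinates; prefactor
`ρ⁻³`).  The sharp constant over the shell `{ρ/2 < |y| < ρ}` is `3π²/4`; any `c₁ ≥ 0` feeds the
join. -/
def MeridionalPecletDominated : Prop :=
  VelocityDominated (4 * Real.pi) meridionalPeclet

/-- S-18.1 holds. -/
theorem meridionalPecletDominated_holds : MeridionalPecletDominated :=
  meridionalPeclet_velocityDominated

/-- **N₀^{full} for the meridional Péclet gauge** — ROUND-17's `MeridionalSwirlLaw κ` at `a = b`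
in the full CKN gauge — follows from P₀ ALONE (S-18.1 is proved), for every `κ₀ > 0`. -/
theorem meridionalBudget_of_polynomialBound
    (hP : SwirlFreePolynomialBound) {κ₀ : ℝ} (hκ₀ : 0 < κ₀) :
    SwirlFreeBudget meridionalPeclet κ₀ :=
  swirlFreeBudget_of_polynomialBound (by positivity) meridionalPecletDominated_holds hP hκ₀

/-- … and the literal seed s17-1 (A-only frame) follows from the A-only P₀ alone. -/
theorem meridionalBudgetA_of_polynomialBoundA
    (hP : SwirlFreePolynomialBoundA) {κ₀ : ℝ} (hκ₀ : 0 < κ₀) :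
    SwirlFreeBudgetA meridionalPeclet κ₀ :=
  swirlFreeBudgetA_of_polynomialBoundA (by positivity) meridionalPecletDominated_holds hP hκ₀


end

end Summit.NavierStokesRegularity.NavierStokesRegularity.Theorems.SwirlFreeBudget
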